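/- Copyright: the b2b-balaban cell (near-miss cell 7), T⁴-continuum fan-out, lineage t4-ne7b-p1 (node U5c COUNT
member).  Released under the licence of the surrounding project. -/
import Summits.QuantumFields.BalabanUV.T4Continuum.Support.HistoryFlow

/-!
# The history socket, CELL-TAGGED: live structures are (root cell, genealogy) pairs

Summits-side support leaf of the T⁴-continuum cell (rung (B)+1 on a FINITE torus only; NOT infinite volume, NOT the
mass gap, NOT the Clay statement; NOT a proof of the spine estimate NE7b).  Lineage `t4-ne7b-p1` (generation 22),
node U5c; owner∕typer repair of the ROUND-2 socket before the swarm rows H2b∕H2e∕P build on it.  [folklore]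
bookkeeping over the lineage's OWN typed carrier; nothing is quoted from print and nothing printed is asserted; no
`[cite:]` tag.

WHY (located finding F-ne7bp1g22-2 of the cell's records).  `HistorySocket.LiveHistories` stores the live structures of
a bad class as a `Finset (Gen PEv)` with a root-cell map `cellOf K : Gen PEv → γ` — a FUNCTION OF THE GENEALOGY.  A
genealogy is a tree of event TYPES `(step, kind, fatness class)`; two pending components of one term born at the same
step with the same fatness class and without further events (the generic case: two isolated unit regions) have THE SAME
genealogy `Gen.born (j, 0, d′) j` at DIFFERENT root cells — the untagged socket can neither hold both nor give them two
cells.  THIS LEAF re-types the socket over CELL-TAGGED live structures `(z, G) : γ × Gen PEv` (slot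
`⟨G.rootStep, z, G.root, record⟩`, exactly the count's slot), re-derives the exit's four (ID) binders and the END forms
(generic; along the tuned runs of `HistoryFlow`), and embeds the untagged socket as the image special case (so
`HistorySocketWitness.liveHistories_w` is an instance here too).  Slot-injectivity now reads «distinct pending
components born at the same step have distinct root cells», not «… have distinct event trees».

WHAT.  §1 `slotOfT`, `InLiveT`, `structure LiveHistoriesT` (eleven fields; `G ↦ q.2`, `cellOf K G ↦ q.1`).  §2 the
derived binders (`yOfT`, `hlabZ_of_liveT`, `strOfT`, `hinj_of_liveT`, `hstr_of_liveT`, `hF_of_liveT`, `hF'_of_liveT`).  §3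
**`relWeightBound_of_liveHistoriesT`**, **`hybridNE7_of_liveHistoriesT`** (generic flow binders),
**`hybridNE7_of_liveHistoriesT_tuned`** (flow binders along the tuned runs, `HistoryFlow`).  §4
`liveHistoriesT_of_untagged`: the untagged socket is the image special case.
HONEST.  Re-typing of OUR socket; proves no estimate of Bałaban's; (ID), (P), (B), BetaPertH stay displayed; NE7b NOT
proved.  HONEST DEPENDENCY (cell): continuum YM on T⁴ ⇐ BetaPertH ∧ nine spine estimates (0/9 proved); BetaPertH ⇐
(D1) ∧ (D4) ∧ CAP+tail.  This file changes none of it. -/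

open Finset
open Literature.MathematicalPhysics.QuantumFieldTheory.Balaban1983to89
open T4PersistenceDictionary T4PersistentHistoryCount T4BankedInduction T4PrintedShapeBanking T4WeightBudget
open T4GlobalDenominator T4LiveClassFibration T4LiveStructureGas T4RecordPriceSeam T4IndicatorShell T4MatchingAssembly
open T4MatchingClosure T4MatchingClosureSocket T4PartnerMultiplicity T4Continuum
open Summit.QuantumFields.BalabanUV.T4Continuum.PartnerMultiplicityF
open Summit.QuantumFields.BalabanUV.T4Continuum.Crowding
open Summit.QuantumFields.BalabanUV.T4Continuum.CountThresholdUniform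
open Summit.QuantumFields.BalabanUV.T4Continuum.CountSeamJunction
open Summit.QuantumFields.BalabanUV.T4Continuum.HistorySocket
open Summit.QuantumFields.BalabanUV.T4Continuum.HistoryFlow

namespace Summit.QuantumFields.BalabanUV.T4Continuum.HistorySocketTagged

noncomputable section

/-! ## §1 Tagged slots, membership, the socket -/

section Defs

variable {γ κ : Type*}

/-- **THE SLOT OF A CELL-TAGGED GENEALOGY**: (root step, root cell, root event, record). [folklore] -/
def slotOfT (p : γ × Gen PEv) : Slot γ PEv := ⟨p.2.rootStep, p.1, p.2.root, p.2.events.erase p.2.root⟩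

/-- `p` is LIVE at cutoff `K`: a member of the live family of some bad class at some admissible source. [folklore] -/
def InLiveT (l₀ : ℝ) (Bad' : ℕ → ℝ → Finset κ) (live : ℕ → κ → Finset (γ × Gen PEv)) (K : ℕ) (p : γ × Gen PEv) :
    Prop :=
  ∃ t : ℝ, |t| ≤ l₀ ∧ ∃ c ∈ Bad' K t, p ∈ live K c

/-- **THE CELL-TAGGED HISTORY SOCKET.**  Data: per cutoff `K` and class `c` the finite set `live K c` of LIVE STRUCTURES
`(root cell, genealogy)`.  Obligations as in `HistorySocket.LiveHistories` ((H2b), (H2e), (P)), over pairs. [folklore] -/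
structure LiveHistoriesT (C : T4PrintedShapeBanking.Consts) (Kz p σ Λ' : ℝ) (l₀ : ℝ) (K₀ : ℕ) (R : ℕ → ℕ → ℕ)
    (g : ℕ → ℕ → ℝ) (Cell : ℕ → ℕ → Finset γ) (E B : ℕ → ℕ → Finset PEv) (jstar : ℕ → ℕ)
    (Bad' : ℕ → ℝ → Finset κ) (F Rf F' Rf' : ℕ → κ → ℝ) (live : ℕ → κ → Finset (γ × Gen PEv)) : Prop where
  /-- (H2b) live genealogies are consistent at their cutoff -/
  consistent : ∀ K q, K₀ ≤ K → InLiveT l₀ Bad' live K q → Consistent C K (R K) q.2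
  /-- (H2b) … and well formed for the run's window table -/
  wf : ∀ K q, K₀ ≤ K → InLiveT l₀ Bad' live K q → q.2.WF (dictW (R K) C.n₁)
  /-- (H2b) … and pending at the cutoff -/
  pending : ∀ K q, K₀ ≤ K → InLiveT l₀ Bad' live K q → K < q.2.reach (dictW (R K) C.n₁)
  /-- (H2e) the root cell is a cell of the root's age -/
  cell_mem : ∀ K q, K₀ ≤ K → InLiveT l₀ Bad' live K q → q.1 ∈ Cell K (K - q.2.rootStep)
  /-- (H2e) the root is a birth kind of its slot -/
  root_mem : ∀ K q, K₀ ≤ K → InLiveT l₀ Bad' live K q → q.2.root ∈ B K q.2.rootStep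
  /-- (H2e) the record lies in the event table of its slot -/
  events_sub : ∀ K q, K₀ ≤ K → InLiveT l₀ Bad' live K q → q.2.events.erase q.2.root ⊆ E K q.2.rootStep
  /-- (H2e) every bad class has an OLD live member (born before the matching scale) -/
  old : ∀ K t, |t| ≤ l₀ → K₀ ≤ K → ∀ c ∈ Bad' K t, ∃ q ∈ live K c, q.2.rootStep < jstar K
  /-- (H2e) distinct live structures of a cutoff occupy distinct slots -/
  slot_inj : ∀ K q q', K₀ ≤ K → InLiveT l₀ Bad' live K q → InLiveT l₀ Bad' live K q' →
    slotOfT q = slotOfT q' → q = q'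
  /-- (H2e) distinct bad classes have distinct live families -/
  live_inj : ∀ K t, |t| ≤ l₀ → K₀ ≤ K → Set.InjOn (live K) (Bad' K t)
  /-- (P) run A: the class price is dominated by the product of the members' labelled shapes -/
  price : ∀ K t, |t| ≤ l₀ → K₀ ≤ K → ∀ c ∈ Bad' K t, F K c * Rf K c ≤ ∏ q ∈ live K c, shapeZ C Kz p σ Λ' R g K q.2
  /-- (P) run A′: the same -/
  price' : ∀ K t, |t| ≤ l₀ → K₀ ≤ K → ∀ c ∈ Bad' K t, F' K c * Rf' K c ≤ ∏ q ∈ live K c, shapeZ C Kz p σ Λ' R g K q.2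

end Defs

/-! ## §2 The four (ID) binders of the exit, DERIVED from the tagged socket -/

section Derived

variable {γ κ : Type*} {C : T4PrintedShapeBanking.Consts} {Kz p σ Λ' l₀ : ℝ}
  {K₀ : ℕ} {R : ℕ → ℕ → ℕ} {g : ℕ → ℕ → ℝ} {Cell : ℕ → ℕ → Finset γ} {E B : ℕ → ℕ → Finset PEv} {jstar : ℕ → ℕ}
  {Bad' : ℕ → ℝ → Finset κ} {F Rf F' Rf' : ℕ → κ → ℝ} {live : ℕ → κ → Finset (γ × Gen PEv)}

/-- **THE LABELLED PRICE**: on a slot occupied by a live structure, its genealogy's labelled shape; `0` elsewhere. [folklore] -/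
def yOfT (C : T4PrintedShapeBanking.Consts) (Kz p σ Λ' l₀ : ℝ) (R : ℕ → ℕ → ℕ) (g : ℕ → ℕ → ℝ)
    (Bad' : ℕ → ℝ → Finset κ) (live : ℕ → κ → Finset (γ × Gen PEv)) (K j : ℕ) (z : γ) (b : PEv) (Q : Finset PEv) : ℝ :=
  haveI := Classical.dec (∃ q, InLiveT l₀ Bad' live K q ∧ slotOfT q = ⟨j, z, b, Q⟩)
  if h : ∃ q, InLiveT l₀ Bad' live K q ∧ slotOfT q = ⟨j, z, b, Q⟩ then shapeZ C Kz p σ Λ' R g K (Classical.choose h).2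
  else 0

/-- the labelled price is nonnegative [folklore] -/
theorem yOfT_nonneg (hKz : 1 ≤ Kz) (hσ : 0 ≤ σ) (hΛ : 0 ≤ Λ') (K j : ℕ) (z : γ) (b : PEv) (Q : Finset PEv) :
    0 ≤ yOfT C Kz p σ Λ' l₀ R g Bad' live K j z b Q := by
  unfold yOfT; split_ifs; exacts [shapeZ_nonneg hKz hσ hΛ R g K _, le_rfl]

/-- **THE PRICE ON AN OCCUPIED SLOT IS THE OCCUPANT'S SHAPE.** [folklore] -/
theorem yOfT_slotOfT (H : LiveHistoriesT C Kz p σ Λ' l₀ K₀ R g Cell E B jstar Bad' F Rf F' Rf' live) {K : ℕ}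
    (hK : K₀ ≤ K) {q : γ × Gen PEv} (hq : InLiveT l₀ Bad' live K q) :
    yOfT C Kz p σ Λ' l₀ R g Bad' live K q.2.rootStep q.1 q.2.root (q.2.events.erase q.2.root) =
      shapeZ C Kz p σ Λ' R g K q.2 := by
  have h : ∃ q', InLiveT l₀ Bad' live K q' ∧
      slotOfT q' = ⟨q.2.rootStep, q.1, q.2.root, q.2.events.erase q.2.root⟩ := ⟨q, hq, rfl⟩
  unfold yOfT
  rw [dif_pos h]
  have hspec := Classical.choose_spec h
  have heq : Classical.choose h = q := H.slot_inj K _ _ hK hspec.1 hq (by rw [hspec.2]; rfl)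
  rw [heq]

/-- **`hlabZ` FROM THE TAGGED SOCKET.** [folklore] -/
theorem hlabZ_of_liveT (H : LiveHistoriesT C Kz p σ Λ' l₀ K₀ R g Cell E B jstar Bad' F Rf F' Rf' live)
    (K : ℕ) (hK : K₀ ≤ K) (j : ℕ) (_hj : j ≤ K) (z : γ) (_hz : z ∈ Cell K (K - j)) (b : PEv) (_hb : b ∈ B K j)
    (Q : Finset PEv) (_hQ : Q ∈ records (dictW (R K) C.n₁) j K (E K j) b) :
    yOfT C Kz p σ Λ' l₀ R g Bad' live K j z b Q ≤ 0 ∨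
      ∃ G : Gen PEv, Consistent C K (R K) G ∧ G.WF (dictW (R K) C.n₁) ∧ G.rootStep = j ∧
        K < G.reach (dictW (R K) C.n₁) ∧ G.root = b ∧ G.events.erase G.root = Q ∧
        yOfT C Kz p σ Λ' l₀ R g Bad' live K j z b Q ≤
          Kz ^ (merges G).card * (∏ e ∈ merges G, Crowding.Q (wcnt G) σ e.step ^ p) *
            Λ' ^ partnerAges PEv.step G * (Real.exp (-credits (credit C (g K)) G) *
              Real.exp (lifeCost (dictW (R K) C.n₁) (cost C K (R K)) G)) := by
  by_cases h : ∃ q, InLiveT l₀ Bad' live K q ∧ slotOfT q = ⟨j, z, b, Q⟩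
  · obtain ⟨q, hq, hs⟩ := h
    simp only [slotOfT, Sigma.mk.inj_iff, heq_eq_eq] at hs
    obtain ⟨rfl, rfl, rfl, rfl⟩ := hs
    refine Or.inr ⟨q.2, H.consistent K q hK hq, H.wf K q hK hq, rfl, H.pending K q hK hq, rfl, rfl, ?_⟩
    rw [yOfT_slotOfT H hK hq]; exact le_of_eq rfl
  · left
    unfold yOfT; rw [dif_neg h]

/-- the slot map is injective on a live family [folklore] -/
theorem slotOfT_injOn (H : LiveHistoriesT C Kz p σ Λ' l₀ K₀ R g Cell E B jstar Bad' F Rf F' Rf' live) {K : ℕ}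
    (hK : K₀ ≤ K) {t : ℝ} (ht : |t| ≤ l₀) {c : κ} (hc : c ∈ Bad' K t) :
    Set.InjOn (slotOfT (γ := γ)) (live K c : Set (γ × Gen PEv)) := fun q hq q' hq' h =>
  H.slot_inj K q q' hK ⟨t, ht, c, hc, hq⟩ ⟨t, ht, c, hc, hq'⟩ h

variable [DecidableEq γ]

/-- **THE LIVE FAMILIES OF SLOTS**: the slots of the class's live structures. [folklore] -/
def strOfT (live : ℕ → κ → Finset (γ × Gen PEv)) (K : ℕ) (c : κ) : Finset (Slot γ PEv) := (live K c).image slotOfT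

/-- **`hinj` FROM THE TAGGED SOCKET.** [folklore] -/
theorem hinj_of_liveT (H : LiveHistoriesT C Kz p σ Λ' l₀ K₀ R g Cell E B jstar Bad' F Rf F' Rf' live)
    (K : ℕ) (t : ℝ) (ht : |t| ≤ l₀) (hK : K₀ ≤ K) : Set.InjOn (strOfT live K) (Bad' K t) := by
  intro c hc c' hc' h
  apply H.live_inj K t ht hK hc hc'
  have key : ∀ {d d' : κ}, d ∈ Bad' K t → d' ∈ Bad' K t → strOfT live K d = strOfT live K d' →
      live K d ⊆ live K d' := by
    intro d d' hd hd' hdd q hq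
    have hmem : slotOfT q ∈ strOfT live K d' := by rw [← hdd]; exact mem_image_of_mem _ hq
    obtain ⟨q', hq', hs⟩ := mem_image.1 hmem
    have := H.slot_inj K q' q hK ⟨t, ht, d', hd', hq'⟩ ⟨t, ht, d, hd, hq⟩ hs
    rw [← this]; exact hq'
  exact Subset.antisymm (key hc hc' h) (key hc' hc h.symm)

/-- **`hstr` FROM THE TAGGED SOCKET.** [folklore] -/
theorem hstr_of_liveT (H : LiveHistoriesT C Kz p σ Λ' l₀ K₀ R g Cell E B jstar Bad' F Rf F' Rf' live)
    (K : ℕ) (t : ℝ) (ht : |t| ≤ l₀) (hK : K₀ ≤ K) :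
    ∀ c ∈ Bad' K t, strOfT live K c ⊆ liveSlots Cell (dictW (R K) C.n₁) E B K ∧
      ∃ o ∈ oldSlots Cell (dictW (R K) C.n₁) E B jstar K, o ∈ strOfT live K c := by
  intro c hc
  have hslot : ∀ q ∈ live K c, q.2.rootStep ≤ K ∧
      q.2.events.erase q.2.root ∈ records (dictW (R K) C.n₁) q.2.rootStep K (E K q.2.rootStep) q.2.root := by
    intro q hq
    have hin : InLiveT l₀ Bad' live K q := ⟨t, ht, c, hc, hq⟩
    have hcG := H.consistent K q hK hin
    refine ⟨?_, Gen.mem_records (H.wf K q hK hin) (H.pending K q hK hin) (H.events_sub K q hK hin)⟩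
    have h1 := (Consistent.root_spec hcG).2
    have h2 := step_le_of_consistent hcG q.2.root q.2.root_mem
    omega
  refine ⟨fun s hs => ?_, ?_⟩
  · obtain ⟨q, hq, rfl⟩ := mem_image.1 hs
    have hin : InLiveT l₀ Bad' live K q := ⟨t, ht, c, hc, hq⟩
    obtain ⟨hle, hrec⟩ := hslot q hq
    simp only [liveSlots, slotOfT, mem_sigma, mem_range]
    exact ⟨Nat.lt_succ_of_le hle, H.cell_mem K q hK hin, H.root_mem K q hK hin, hrec⟩
  · obtain ⟨q, hq, hold⟩ := H.old K t ht hK c hc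
    have hin : InLiveT l₀ Bad' live K q := ⟨t, ht, c, hc, hq⟩
    obtain ⟨-, hrec⟩ := hslot q hq
    refine ⟨slotOfT q, ?_, mem_image_of_mem _ hq⟩
    simp only [oldSlots, slotOfT, mem_sigma, mem_range]
    exact ⟨hold, H.cell_mem K q hK hin, H.root_mem K q hK hin, hrec⟩

/-- **THE FAMILY WEIGHT OF A SLOT FAMILY IS THE PRODUCT OF THE MEMBERS' SHAPES.** [folklore] -/
theorem famWeight_strOfT (H : LiveHistoriesT C Kz p σ Λ' l₀ K₀ R g Cell E B jstar Bad' F Rf F' Rf' live)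
    {K : ℕ} (hK : K₀ ≤ K) {t : ℝ} (ht : |t| ≤ l₀) {c : κ} (hc : c ∈ Bad' K t) :
    famWeight (slotPrice (yOfT C Kz p σ Λ' l₀ R g Bad' live K)) (strOfT live K c) =
      ∏ q ∈ live K c, shapeZ C Kz p σ Λ' R g K q.2 := by
  rw [famWeight, strOfT, prod_image (slotOfT_injOn H hK ht hc)]
  refine prod_congr rfl fun q hq => ?_
  simp only [slotOfT, slotPrice]
  exact yOfT_slotOfT H hK ⟨t, ht, c, hc, hq⟩

/-- **`hF` FROM THE TAGGED SOCKET.** [folklore] -/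
theorem hF_of_liveT (H : LiveHistoriesT C Kz p σ Λ' l₀ K₀ R g Cell E B jstar Bad' F Rf F' Rf' live)
    (K : ℕ) (t : ℝ) (ht : |t| ≤ l₀) (hK : K₀ ≤ K) :
    ∀ c ∈ Bad' K t, F K c * Rf K c ≤ famWeight (slotPrice (yOfT C Kz p σ Λ' l₀ R g Bad' live K)) (strOfT live K c) :=
  fun c hc => by rw [famWeight_strOfT H hK ht hc]; exact H.price K t ht hK c hc

/-- **`hF′` FROM THE TAGGED SOCKET.** [folklore] -/
theorem hF'_of_liveT (H : LiveHistoriesT C Kz p σ Λ' l₀ K₀ R g Cell E B jstar Bad' F Rf F' Rf' live)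
    (K : ℕ) (t : ℝ) (ht : |t| ≤ l₀) (hK : K₀ ≤ K) :
    ∀ c ∈ Bad' K t, F' K c * Rf' K c ≤ famWeight (slotPrice (yOfT C Kz p σ Λ' l₀ R g Bad' live K)) (strOfT live K c) :=
  fun c hc => by rw [famWeight_strOfT H hK ht hc]; exact H.price' K t ht hK c hc

end Derived

/-! ## §3 The exit and the seam form over the tagged socket (generic flow binders; flow binders along tuned runs) -/

section Exit

variable {γ κ ι : Type*} [DecidableEq γ] [DecidableEq κ] [DecidableEq ι] {l₀ vol : ℝ} {K₀ : ℕ} {π : ℕ → ι → κ}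
  {T : ℕ → Finset ι} {A A' shA shB : ℕ → ℝ → ι → ℝ} {Bad' : ℕ → ℝ → Finset κ} {dead dead' : ℕ → ℝ → ι → ℝ}
  {Fc Rf Fc' Rf' : ℕ → κ → ℝ} {nlow nup mlow mup : ℕ → ℝ → ℝ} {Cn : ℝ}
  {Cc Rr CcRec RrRec : ℕ → ℝ → ι → ℝ} {ν u s₂ c₀ r s Wsh : ℕ → ℝ}

omit [DecidableEq ι] in
/-- **NE7b's COUNT EXIT OVER THE TAGGED SOCKET**: `CountThresholdUniform.relWeightBoundZ_of_irThreshold`, its four (ID)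
binders REPLACED by ONE `LiveHistoriesT` hypothesis; everything else verbatim. [folklore] -/
theorem relWeightBound_of_liveHistoriesT {C : T4PrintedShapeBanking.Consts} {L rr : ℕ} {β₀ : ℝ}
    (h : ThresholdOK C L rr β₀)
    {Kz p σ ε θ : ℝ} (hKz : 1 ≤ Kz) (hp : 0 ≤ p) (h0 : 0 < σ) (h1 : σ < 1) (hε : 0 < ε) (hθ : 0 < θ)
    (Cell : ℕ → ℕ → Finset γ) {V Λ : ℝ} (hV : 0 ≤ V) (hΛ : 0 < Λ)
    (hcell : ∀ K a, ((Cell K a).card : ℝ) ≤ V * Λ ^ a) (E Bk : ℕ → ℕ → Finset PEv)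
    (hE : ∀ K j, ∀ e ∈ E K j, PEv.step e ∈ Ioc j K) (jstar : ℕ → ℕ) (hj : ∀ K, jstar K ≤ K) {c : ℝ} (hc : 0 < c)
    (hfrac : ∀ K : ℕ, c * K ≤ ((K - jstar K : ℕ) : ℝ))
    (hA : Regeneration l₀ π T A Bad' dead Fc Rf nlow nup Cn K₀)
    (hA' : Regeneration l₀ π T A' Bad' dead' Fc' Rf' mlow mup Cn K₀) (hCn : 0 ≤ Cn)
    (R : ℕ → ℕ → ℕ) (g : ℕ → ℕ → ℝ) (β' : ℕ → ℝ)
    (h27 : ∀ K, K₀ ≤ K → B14.FlowIneq27 (g K) (β' K) β₀ C.p₀ K)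
    (h29 : ∀ K, K₀ ≤ K → B14FlowStep.FlowIneq29 (R K) (g K) L (β' K) β₀ K)
    (hR : ∀ K, K₀ ≤ K → ∀ s, s ≤ K → B14.IsRj L rr (g K s) (R K s))
    (hx1 : ∀ K, K₀ ≤ K → ∀ s, s ≤ K → 1 ≤ Real.log ((g K s) ^ 2)⁻¹)
    (hir : ∀ K, K₀ ≤ K → irThresholdZ C Kz p σ ε θ L rr β₀ ≤ Real.log ((g K K) ^ 2)⁻¹)
    {ρbar ηbar : ℝ} (hρbar : ∀ K j, ∑ b ∈ Bk K j, rho C (g K) b ≤ ρbar)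
    (hηbar : ∀ K j, ∀ t ∈ Ioc j K, ∑ e ∈ E K j with PEv.step e = t, eta C e ≤ ηbar)
    (hrate : Λ * Real.exp (ηbar - C.κ₁) < 1) {Λ' : ℝ} (hΛ0 : 0 ≤ Λ') (hΛ1 : Λ' * Real.exp ε * Real.exp (-C.κ₁) ≤ 1)
    {live : ℕ → κ → Finset (γ × Gen PEv)}
    (H : LiveHistoriesT C Kz p σ Λ' l₀ K₀ R g Cell E Bk jstar Bad' Fc Rf Fc' Rf' live) :
    ∃ K₁, K₀ ≤ K₁ ∧ RelWeightBound l₀ T A A' (fun K t => if K₁ ≤ K then badOfClass π T Bad' K t else ∅)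
      (Set.indicator {K | K₁ ≤ K} (fun K => Cn * recordsBudget ρbar C.κ₁ V Λ ηbar jstar K)) :=
  relWeightBoundZ_of_irThreshold h hKz hp h0 h1 hε hθ Cell hV hΛ hcell E Bk hE jstar hj hc hfrac hA hA' hCn R g β'
    h27 h29 hR hx1 hir hρbar hηbar hrate hΛ0 hΛ1 (yOfT C Kz p σ Λ' l₀ R g Bad' live)
    (fun K j _ z _ b _ Q _ => yOfT_nonneg hKz h0.le hΛ0 K j z b Q) (hlabZ_of_liveT H) (strOfT live)
    (hinj_of_liveT H) (hstr_of_liveT H) (hF_of_liveT H) (hF'_of_liveT H)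

/-- **… AND INTO THE SEAM** (generic flow binders). [folklore] -/
theorem hybridNE7_of_liveHistoriesT {C : T4PrintedShapeBanking.Consts} {L rr : ℕ} {β₀ : ℝ}
    (h : ThresholdOK C L rr β₀)
    {Kz p σ ε θ : ℝ} (hKz : 1 ≤ Kz) (hp : 0 ≤ p) (h0 : 0 < σ) (h1 : σ < 1) (hε : 0 < ε) (hθ : 0 < θ)
    (Cell : ℕ → ℕ → Finset γ) {V Λ : ℝ} (hV : 0 ≤ V) (hΛ : 0 < Λ)
    (hcell : ∀ K a, ((Cell K a).card : ℝ) ≤ V * Λ ^ a) (E Bk : ℕ → ℕ → Finset PEv)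
    (hE : ∀ K j, ∀ e ∈ E K j, PEv.step e ∈ Ioc j K) (jstar : ℕ → ℕ) (hj : ∀ K, jstar K ≤ K) {c : ℝ} (hc : 0 < c)
    (hfrac : ∀ K : ℕ, c * K ≤ ((K - jstar K : ℕ) : ℝ))
    (hA : Regeneration l₀ π T A Bad' dead Fc Rf nlow nup Cn K₀)
    (hA' : Regeneration l₀ π T A' Bad' dead' Fc' Rf' mlow mup Cn K₀) (hCn : 0 ≤ Cn)
    (R : ℕ → ℕ → ℕ) (g : ℕ → ℕ → ℝ) (β' : ℕ → ℝ)
    (h27 : ∀ K, K₀ ≤ K → B14.FlowIneq27 (g K) (β' K) β₀ C.p₀ K)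
    (h29 : ∀ K, K₀ ≤ K → B14FlowStep.FlowIneq29 (R K) (g K) L (β' K) β₀ K)
    (hR : ∀ K, K₀ ≤ K → ∀ s, s ≤ K → B14.IsRj L rr (g K s) (R K s))
    (hx1 : ∀ K, K₀ ≤ K → ∀ s, s ≤ K → 1 ≤ Real.log ((g K s) ^ 2)⁻¹)
    (hir : ∀ K, K₀ ≤ K → irThresholdZ C Kz p σ ε θ L rr β₀ ≤ Real.log ((g K K) ^ 2)⁻¹)
    {ρbar ηbar : ℝ} (hρbar : ∀ K j, ∑ b ∈ Bk K j, rho C (g K) b ≤ ρbar)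
    (hηbar : ∀ K j, ∀ t ∈ Ioc j K, ∑ e ∈ E K j with PEv.step e = t, eta C e ≤ ηbar)
    (hrate : Λ * Real.exp (ηbar - C.κ₁) < 1) {Λ' : ℝ} (hΛ0 : 0 ≤ Λ') (hΛ1 : Λ' * Real.exp ε * Real.exp (-C.κ₁) ≤ 1)
    {live : ℕ → κ → Finset (γ × Gen PEv)}
    (H : LiveHistoriesT C Kz p σ Λ' l₀ K₀ R g Cell E Bk jstar Bad' Fc Rf Fc' Rf' live)
    (hSh : ShellWeightBound l₀ T A A' shA shB Wsh)
    (hTB : ReindexedBudget l₀ vol T (fun K t τ => A K t τ - shA K t τ) (fun K t τ => A' K t τ - shB K t τ)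
      (badOfClass π T Bad') Cc Rr CcRec RrRec ν u s₂ c₀ r s)
    (hr : Summable r) (hu : Summable u) (hs : Summable s) (hs₂ : Summable s₂) :
    ∃ K₁ K₂, K₀ ≤ K₁ ∧ HybridNE7 l₀ vol (fun K => T (K₁ + (K₂ + K))) (fun K => A (K₁ + (K₂ + K)))
      (fun K => A' (K₁ + (K₂ + K))) (fun K => badOfClass π T Bad' (K₁ + (K₂ + K)))
      (fun K => Cn * recordsBudget ρbar C.κ₁ V Λ ηbar jstar (K₁ + (K₂ + K)))
      (fun K => shA (K₁ + (K₂ + K))) (fun K => shB (K₁ + (K₂ + K))) (fun K => Wsh (K₁ + (K₂ + K)))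
      (fun K => (r (K₁ + (K₂ + K)) + u (K₁ + (K₂ + K))) + (s (K₁ + (K₂ + K)) + s₂ (K₁ + (K₂ + K)))) :=
  hybridNE7_of_eventually
    (relWeightBound_of_liveHistoriesT h hKz hp h0 h1 hε hθ Cell hV hΛ hcell E Bk hE jstar hj hc hfrac hA hA' hCn R g
      β' h27 h29 hR hx1 hir hρbar hηbar hrate hΛ0 hΛ1 H)
    hSh hTB hr hu hs hs₂

variable {F : T4Family} {G : Type*} [GaugeGroup G] [MeasurableSpace G] [HaarData G]

/-- **… AND INTO THE SEAM, ALONG THE TUNED RUNS** (`HistoryFlow.hybridNE7_of_liveHistories_tuned` over the tagged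
socket: flow binders ⇐ box β-bounds, `SmallnessFor`, tuning, `irThresholdZ ≤ log g⁻²`; `hR` = (2.5) side condition). [folklore] -/
theorem hybridNE7_of_liveHistoriesT_tuned (D : FiniteEpsData F G) {C : T4PrintedShapeBanking.Consts} {rr : ℕ}
    {β₀ : ℝ} (h : ThresholdOK C F.L rr β₀)
    {γ₀ γb b β' gc : ℝ} {pe : ℕ} (hb : 0 ≤ b) (hlo : FlowStep.BetaLowerH b γ₀ D.βfun)
    (hhi : FlowStep.BetaUpperH β' γ₀ D.βfun) (hγ : γb ≤ γ₀) (hγβ : γb ^ 2 * β' < 1)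
    (S : B14FlowStep.SmallnessFor γb β' β₀ F.L pe) (hp₀ : C.p₀ ≤ pe) (hrr : rr ≤ pe)
    {g₀ : ℕ → ℝ} (ht : D.Tuned γb gc g₀)
    {Kz p σ ε θ : ℝ} (hKz : 1 ≤ Kz) (hp : 0 ≤ p) (h0 : 0 < σ) (h1 : σ < 1) (hε : 0 < ε) (hθ : 0 < θ)
    (hir : irThresholdZ C Kz p σ ε θ F.L rr β₀ ≤ Real.log (gc ^ 2)⁻¹)
    (Cell : ℕ → ℕ → Finset γ) {V Λ : ℝ} (hV : 0 ≤ V) (hΛ : 0 < Λ)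
    (hcell : ∀ K a, ((Cell K a).card : ℝ) ≤ V * Λ ^ a) (E Bk : ℕ → ℕ → Finset PEv)
    (hE : ∀ K j, ∀ e ∈ E K j, PEv.step e ∈ Ioc j K) (jstar : ℕ → ℕ) (hj : ∀ K, jstar K ≤ K) {c : ℝ} (hc : 0 < c)
    (hfrac : ∀ K : ℕ, c * K ≤ ((K - jstar K : ℕ) : ℝ))
    (hA : Regeneration l₀ π T A Bad' dead Fc Rf nlow nup Cn K₀)
    (hA' : Regeneration l₀ π T A' Bad' dead' Fc' Rf' mlow mup Cn K₀) (hCn : 0 ≤ Cn)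
    (R : ℕ → ℕ → ℕ) (hR : ∀ K s, s ≤ K → B14.IsRj F.L rr ((D.C ⟨K, F.m, g₀ K⟩).flow.g s) (R K s))
    {ρbar ηbar : ℝ} (hρbar : ∀ K j, ∑ b ∈ Bk K j, rho C ((D.C ⟨K, F.m, g₀ K⟩).flow.g) b ≤ ρbar)
    (hηbar : ∀ K j, ∀ t ∈ Ioc j K, ∑ e ∈ E K j with PEv.step e = t, eta C e ≤ ηbar)
    (hrate : Λ * Real.exp (ηbar - C.κ₁) < 1) {Λ' : ℝ} (hΛ0 : 0 ≤ Λ') (hΛ1 : Λ' * Real.exp ε * Real.exp (-C.κ₁) ≤ 1)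
    {live : ℕ → κ → Finset (γ × Gen PEv)}
    (H : LiveHistoriesT C Kz p σ Λ' l₀ K₀ R (fun K => (D.C ⟨K, F.m, g₀ K⟩).flow.g) Cell E Bk jstar Bad' Fc Rf Fc'
      Rf' live)
    (hSh : ShellWeightBound l₀ T A A' shA shB Wsh)
    (hTB : ReindexedBudget l₀ vol T (fun K t τ => A K t τ - shA K t τ) (fun K t τ => A' K t τ - shB K t τ)
      (badOfClass π T Bad') Cc Rr CcRec RrRec ν u s₂ c₀ r s)
    (hr : Summable r) (hu : Summable u) (hs : Summable s) (hs₂ : Summable s₂) :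
    ∃ K₁ K₂, K₀ ≤ K₁ ∧ HybridNE7 l₀ vol (fun K => T (K₁ + (K₂ + K))) (fun K => A (K₁ + (K₂ + K)))
      (fun K => A' (K₁ + (K₂ + K))) (fun K => badOfClass π T Bad' (K₁ + (K₂ + K)))
      (fun K => Cn * recordsBudget ρbar C.κ₁ V Λ ηbar jstar (K₁ + (K₂ + K)))
      (fun K => shA (K₁ + (K₂ + K))) (fun K => shB (K₁ + (K₂ + K))) (fun K => Wsh (K₁ + (K₂ + K)))
      (fun K => (r (K₁ + (K₂ + K)) + u (K₁ + (K₂ + K))) + (s (K₁ + (K₂ + K)) + s₂ (K₁ + (K₂ + K)))) := by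
  obtain ⟨h27, h29, hx1, -⟩ := flowBinders_of_tuned D hb hlo hhi hγ hγβ S hp₀ hrr ht R hR
  exact hybridNE7_of_liveHistoriesT h hKz hp h0 h1 hε hθ Cell hV hΛ hcell E Bk hE jstar hj hc hfrac hA hA' hCn R
    (fun K => (D.C ⟨K, F.m, g₀ K⟩).flow.g) (fun _ => β') (fun K _ => h27 K) (fun K _ => h29 K)
    (fun K _ s hs => hR K s hs) (fun K _ s hs => hx1 K s hs) (fun K _ => hir_of_tuned D ht hir K) hρbar hηbar hrate
    hΛ0 hΛ1 H hSh hTB hr hu hs hs₂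

end Exit

/-! ## §4 The untagged socket is the image special case -/

section Untagged

variable {γ κ : Type*} [DecidableEq γ] {C : T4PrintedShapeBanking.Consts} {Kz p σ Λ' l₀ : ℝ} {K₀ : ℕ}
  {R : ℕ → ℕ → ℕ} {g : ℕ → ℕ → ℝ} {Cell : ℕ → ℕ → Finset γ} {E B : ℕ → ℕ → Finset PEv} {jstar : ℕ → ℕ}
  {Bad' : ℕ → ℝ → Finset κ} {F Rf F' Rf' : ℕ → κ → ℝ} {live : ℕ → κ → Finset (Gen PEv)} {cellOf : ℕ → Gen PEv → γ}

/-- tagging a genealogy family by its root-cell map [folklore] -/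
def tagged (live : ℕ → κ → Finset (Gen PEv)) (cellOf : ℕ → Gen PEv → γ) (K : ℕ) (c : κ) : Finset (γ × Gen PEv) :=
  (live K c).image fun G => (cellOf K G, G)
/-- a live tagged pair of the image family is `(cellOf K G, G)` for a live `G` [folklore] -/
theorem inLive_of_inLiveT_tagged {K : ℕ} {q : γ × Gen PEv}
    (h : InLiveT l₀ Bad' (tagged live cellOf) K q) : InLive l₀ Bad' live K q.2 ∧ q.1 = cellOf K q.2 := by
  obtain ⟨t, ht, c, hc, hq⟩ := h
  obtain ⟨G, hG, rfl⟩ := mem_image.1 hq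
  exact ⟨⟨t, ht, c, hc, hG⟩, rfl⟩

/-- **THE UNTAGGED SOCKET IS A SPECIAL CASE**: `LiveHistories … live cellOf ⇒ LiveHistoriesT … (tagged live cellOf)`. [folklore] -/
theorem liveHistoriesT_of_untagged
    (H : LiveHistories C Kz p σ Λ' l₀ K₀ R g Cell E B jstar Bad' F Rf F' Rf' live cellOf) :
    LiveHistoriesT C Kz p σ Λ' l₀ K₀ R g Cell E B jstar Bad' F Rf F' Rf' (tagged live cellOf) where
  consistent K q hK h := H.consistent K q.2 hK (inLive_of_inLiveT_tagged h).1
  wf K q hK h := H.wf K q.2 hK (inLive_of_inLiveT_tagged h).1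
  pending K q hK h := H.pending K q.2 hK (inLive_of_inLiveT_tagged h).1
  cell_mem K q hK h := by
    obtain ⟨h1, h2⟩ := inLive_of_inLiveT_tagged h
    rw [h2]; exact H.cell_mem K q.2 hK h1
  root_mem K q hK h := H.root_mem K q.2 hK (inLive_of_inLiveT_tagged h).1
  events_sub K q hK h := H.events_sub K q.2 hK (inLive_of_inLiveT_tagged h).1
  old K t ht hK c hc := by
    obtain ⟨G, hG, hold⟩ := H.old K t ht hK c hc
    exact ⟨(cellOf K G, G), mem_image_of_mem _ hG, hold⟩
  slot_inj K q q' hK h h' hs := by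
    obtain ⟨h1, h2⟩ := inLive_of_inLiveT_tagged h
    obtain ⟨h1', h2'⟩ := inLive_of_inLiveT_tagged h'
    have e : ∀ {o : γ × Gen PEv}, o.1 = cellOf K o.2 → slotOfT o = slotOf cellOf K o.2 := by
      intro o ho; simp only [slotOfT, slotOf, ho]
    have hG : q.2 = q'.2 := H.slot_inj K q.2 q'.2 hK h1 h1' (by rw [← e h2, ← e h2', hs])
    exact Prod.ext (by rw [h2, h2', hG]) hG
  live_inj K t ht hK := by
    intro c hc c' hc' h
    apply H.live_inj K t ht hK hc hc'
    have key : ∀ {d d' : κ}, tagged live cellOf K d = tagged live cellOf K d' → live K d ⊆ live K d' := by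
      intro d d' hdd G hG
      have : (cellOf K G, G) ∈ tagged live cellOf K d' := by rw [← hdd]; exact mem_image_of_mem _ hG
      obtain ⟨G', hG', he⟩ := mem_image.1 this
      simp only [Prod.mk.injEq] at he
      rw [← he.2]; exact hG'
    exact Subset.antisymm (key h) (key h.symm)
  price K t ht hK c hc := by
    rw [tagged, prod_image fun G _ G' _ h => (Prod.ext_iff.1 h).2]; exact H.price K t ht hK c hc
  price' K t ht hK c hc := by
    rw [tagged, prod_image fun G _ G' _ h => (Prod.ext_iff.1 h).2]; exact H.price' K t ht hK c hc

end Untagged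
end
end Summit.QuantumFields.BalabanUV.T4Continuum.HistorySocketTagged
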